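import Summits.HodgeConjecture.HodgeConjecture.Theorems.VHCAbelianSchemesRoadServedFibreDefs
import Literature.AlgebraicGeometry.HodgeTheory.SemiregularVariationalHodgeTwistedPerfect
import Literature.AlgebraicGeometry.Andre1996.CompactPencilReduction
import Summits.Ventures.HSemireg.AmplificationChainSigmaGluable
import HarnessLib

/-!
# Ring 2 / AbelianAll (André column) — the node «CM-ANCHORED (TWISTED) CARRIERS» of the implication table (definitions only)

research route, not a corollary; conditional on HC_CM plus one named minimal statement.

DEFINITIONS ONLY (nothing asserted, nothing proved; `HC_CM` absent). PART AA of ab-andre-2 (gen 58) proved in the kernel the CELL-FREE edge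
`AndreCMAnchoredPencil ∧ door ∧ «carriers on CM abelian varieties» ⟹ HC_AV` (`Theorems/VHCAbelianSchemesRoadServedFibreCM`,
`forall_hodgeConjectureFor_of_cmAnchoredPencil_of_cmAnchoredCarrierAt`) with the CM hypothesis spelled inline. This file NAMES that
hypothesis as a node of the §AbelianAll implication table of `RING2-MAP.md` (a `B_min`-candidate «as small as possible»: ONE statement about
COUNTABLY MANY varieties), in the vocabulary of PART AA-a (`AnchoredCarrierAt`):

* `cmPolarisedAnchor n` (anchor predicate, reducible): the complex scheme `X` is isomorphic to (the variety underlying) a complex abelian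
  variety of dimension `n` OF CM TYPE (`Milne1999.IsOfCMType`, the binder of `HC_CM` by name) and `θ ∈ H²(X(ℂ); ℂ)` is a polarisation class.
* `hodgeTypeClasses n p` (served classes, reducible): the classes of Hodge type `(p,p)` in `H^{2p}(X(ℂ); ℂ)` (rationality is asked separately by
  `AnchoredCarrierAt`).
* `CMAnchoredCarriers 𝒪` (door-generic, `@[conjecture]`): for every relative dimension `n` and codimension `p` with `2 ≤ p`, `2p + 4 ≤ n` (the
  range André's Lemme 6.3.1 uses: carriers on CM `2g`-folds for classes of codimension `2 ≤ p ≤ g − 2`), `AnchoredCarrierAt 𝒪 n p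
  (cmPolarisedAnchor n) (hodgeTypeClasses n p)` — on every `X ≅` CM abelian `n`-fold, for every polarisation class `θ` and every RATIONAL
  `(p,p)` class `w`, an `𝒪`-admissible datum ON `X` with `κ_p = a·w + c_p·θᵖ`, `a ≠ 0`, `κ_q = c_q·θ^q`.
* `CMTwistedCarriers` (`@[conjecture]`): `CMAnchoredCarriers` for the road's twisted door `twistedReflexiveClass C AdmTw`, for EVERY Chern
  character theory `C` (`AdmTw := gluableSigmaAdmissible ∨ bfSingleAdmissible`, as in the crux `SemiregularSheafRepresentativesTwAtDiag`).

Both carrier nodes are OPEN, not in print (Bloch's form `a·z₀ + b·l₀ᵖ` asked of every Hodge class on every CM abelian variety; on powers of a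
CM elliptic curve every Hodge class is Lefschetz, so the demand there concerns Lefschetz classes off the `θ`-ray), STRONGER than `HC_CM`
(semiregular twisted representability instead of algebraicity) and NOT implied by the Hodge conjecture — HYPOTHESES wherever used, never cited
as facts. References: [cite: Bloch1972Semiregularity, Remark (7.5)] [cite: Andre1996Motifs, §6.3 Lemme 6.3.1] [cite: Milne1999, §7 p. 72]
[cite: BuchweitzFlenner2003, §5 Thm. 5.1] [cite: Markman2025SecantWeil, §7.3 and Thm. 1.4.1].
-/

noncomputable section

open CategoryTheory CategoryTheory.Limits AlgebraicGeometry Topology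

namespace Summit.HodgeConjecture.HodgeConjecture.Ring2.AbelianAll

-- the cell's namespace repeats the summit name (`Summit.HodgeConjecture.HodgeConjecture…`), as in every `Ring2*` file
set_option linter.dupNamespace false

open Literature.AlgebraicGeometry Literature.AlgebraicGeometry.Motives
open Literature.AlgebraicGeometry.HodgeTheory
open Literature.AlgebraicTopology.SingularHomology
open Literature.AlgebraicGeometry.Milne1999 (IsOfCMType)
open Summit.Ventures.HSemireg (ObjClass)
open Summit.HodgeConjecture.HodgeConjecture.Ring2.SemiregularRepresentatives (AnchoredCarrierAt)

/-- **CM polarised anchors** (anchor predicate for PART AA's `AnchoredCarrierAt`/`HasServedFibre`): `X` is isomorphic to a complex abelian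
variety of dimension `n` of CM type, and `θ` is a polarisation class of `X` (rational, supported on a divisor, hard Lefschetz). Reducible.
[cite: Milne1999, §7 p. 72] [cite: Andre1996Motifs, Lemme 6.3.1 (ii)] -/
abbrev cmPolarisedAnchor (n : ℕ) : ∀ X : SchemeOver ℂ, complexBetti X 2 → Prop :=
  fun X θ ↦ (∃ A₀ : AbelianVariety ℂ, A₀.dim = n ∧ IsOfCMType A₀ ∧ Nonempty (A₀.X ≅ X)) ∧ IsPolarizationClass n X θ

/-- **Served classes at CM anchors: all classes of Hodge type `(p,p)`** (rationality is asked separately). Reducible.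
[cite: Andre1996Motifs, Lemme 6.3.1] -/
abbrev hodgeTypeClasses (n p : ℕ) : ∀ X : SchemeOver ℂ, complexBetti X 2 → Set (complexBetti X (2 * p)) :=
  fun X _ ↦ {w | IsOfHodgeType n X (2 * p) p p w}

/-- **CM-ANCHORED CARRIERS for the door `𝒪` (`CMAnchoredCarriers 𝒪`)**: for all `n`, `p` with `2 ≤ p`, `2p + 4 ≤ n`, on every complex scheme
isomorphic to a CM abelian `n`-fold, for every polarisation class `θ` and every rational `(p,p)` class `w`: an `𝒪`-admissible datum
`(I ∋ p, κ)` ON IT with `κ_p = a·w + c_p·θᵖ`, `a ≠ 0`, `κ_q = c_q·θ^q` (`q ∈ I`, `q ≠ p`). With André's Lemme 6.3.1 and the door's local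
variational Hodge statement it gives `HC_AV` (PART AA-f); it STRENGTHENS `HC_CM`. OPEN; a HYPOTHESIS wherever used.
[cite: Bloch1972Semiregularity, Remark (7.5)] [cite: Andre1996Motifs, §6.3 Lemme 6.3.1] [cite: Milne1999, §7 p. 72] -/
@[conjecture] def CMAnchoredCarriers (𝒪 : ObjClass) : Prop :=
  ∀ n p : ℕ, 2 ≤ p → 2 * p + 4 ≤ n → AnchoredCarrierAt 𝒪 n p (cmPolarisedAnchor n) (hodgeTypeClasses n p)

/-- **CM-ANCHORED TWISTED CARRIERS (`CMTwistedCarriers`)**: `CMAnchoredCarriers` for the road's twisted door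
`twistedReflexiveClass C AdmTw` — `B`-twisted admissible perfect complexes, `AdmTw := gluableSigmaAdmissible ∨ bfSingleAdmissible` — for EVERY
Chern character theory `C` on Betti cohomology. The `B_min`-candidate of PART AA: ONE statement about countably many varieties which, with
K-C, the door binder `TwistedPerfectDoor` and André's Lemme 6.3.1, gives `HC_AV` without `HC_CM`, K-SR♭∃ or the curve residual (companion
proof file). OPEN; not in print; a HYPOTHESIS wherever used. [cite: Bloch1972Semiregularity, Remark (7.5)] [cite: Markman2025SecantWeil, §7.3 and Thm. 1.4.1]
[cite: BuchweitzFlenner2003, §5 Thm. 5.1] [cite: Andre1996Motifs, §6.3 Lemme 6.3.1] -/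
@[conjecture] def CMTwistedCarriers : Prop :=
  ∀ C : ChernCharacterBetti, CMAnchoredCarriers (twistedReflexiveClass C
    (fun n X₀ I E => Summit.Ventures.HSemireg.gluableSigmaAdmissible n X₀ I E ∨
      Literature.AlgebraicGeometry.HodgeTheory.bfSingleAdmissible n X₀ I E))

end Summit.HodgeConjecture.HodgeConjecture.Ring2.AbelianAll

end
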